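import Summits.ResolutionOfSingularities.ResolutionOfSingularities.Theorems.FrobeniusClosingSteerOddBranchPersistence
import Summits.ResolutionOfSingularities.ResolutionOfSingularities.Theorems.FrobeniusClosingSteerSigmaTopLegalityForest
import Summits.ResolutionOfSingularities.ResolutionOfSingularities.Theorems.FrobeniusClosingSteerQuadraticStepLemmas

/-!
# Crux `Steer` (stmt-ResolutionOfSingularities-16345), chain W4.1, F-B side, (Par-S): NON-PERSISTENCE ⇒ THE EXCEPTIONAL PARAMETER
# SWITCHES BEYOND EVERY STAGE — the run-level bookkeeping brick (S4) of the ARITH-REDUCTION `StrippingTailSwitchingArithTwoN`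
# (res-L0-w41-strat-2 §σ2.28 (g2); res-L0-w41-plan-1 RULINGS 115a/117d/118c; res-L0-w41-tri-1 PREREG-FB v1.6.2 A6; Theses-free support)

OURS (campaign `res-hironaka`, rung L ★L-G4, slot W4.1; statements about the route's own objects — a tower of local blowing ups
`IsLocalBlowupAlong O (R i) (P i) (R (i+1))` along a valuation ring `O`, its POINT steps (`SigmaTopLegality.IsPointStep`: the centre is the
maximal ideal) and their EXCEPTIONAL PARAMETERS (an element of the centre, non-zero, of maximal `O`-value — the body of the skeleton's
`IsExcParamAlong`, UNFOLDED); they replace the role of no printed item and are NOT statements of the manuscript under review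
[claim: Hironaka2017, status: under-review]; AI review is weaker than expert review). Seat res-type-062 g15. Definition-free; no Theses file is
imported; nothing here is a route item.

## What is proved

The (Par-S) words carry the NEGATION of the weak persistence clause of `OddBranchVFree` / `OddBranchPersistence`
(«no `x` of positive value divides, in some later member, every late element of positive value»). This file turns that negation into the
combinatorial statement the ARITH-REDUCTION starts from (tri-1 A6, corrected bookkeeping: «a late parameter switch = a satellite step»):

* §1 `exists_excParam_of_isLocalBlowupAlong` — every local blowing up along `I ≠ 0` HAS an exceptional parameter (the `u₀` of the definition;
  maximality over all of `I` by the ultrametric inequality); `valuation_lt_one_of_not_isUnit` — in a member dominated by `O` non-units have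
  value `< 1`.
* §2 `weakPersistence_of_persistentParam` — if from some point step `j₁` on ONE element `x` is an exceptional parameter at EVERY later point
  step, and point steps recur, then the weak persistence clause holds for `x` (threading: `OddBranchPersistence.div_mem_of_isLocalBlowupAlong`).
* §3 **`exists_switch_beyond_of_not_persistent`** — hence, under the (Par-S) binder `¬ (persistence clause)`, beyond every stage there is a
  point step `j` such that EVERY exceptional parameter `x` of step `j` FAILS to be an exceptional parameter at some LATER point step `j'`
  (the parameter switches); `exists_switch_pair_beyond_of_not_persistent` — in particular beyond every stage there are point steps
  `j < j'` and an exceptional parameter of step `j` that has switched by step `j'`.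

[cite: NovacoskiSpivakovsky2014, Def. 2.11] [cite: HeinzerEtAl2015, Remark 2.4] [folklore]
-/

-- `Summit.<S>.<S>.…` duplicates the summit name by design (single-problem summit).
set_option linter.dupNamespace false

open IsLocalRing
open Literature.AlgebraicGeometry.Resolution (IsLocalBlowupAlong SubringDominates isUnit_subring_iff_inv_mem)

namespace Summit.ResolutionOfSingularities.ResolutionOfSingularities.Theorems.SwitchingDichotomy

namespace SwitchRecurrence

open Summit.ResolutionOfSingularities.ResolutionOfSingularities.Theorems.SwitchingDichotomy.SigmaTopLegality (IsPointStep)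

variable {K : Type} [Field K] {O : ValuationSubring K}

/-! ## §1 Exceptional parameters exist; non-units of dominated members have value `< 1` -/

/-- **Every local blowing up along an ideal has an exceptional parameter**: the generator `u₀` of maximal `O`-value in the definition of
`IsLocalBlowupAlong O B I B'` lies in `I`, is non-zero, and has maximal `O`-value on ALL of `I` (ultrametric inequality over a generating set).
[cite: NovacoskiSpivakovsky2014, Def. 2.11] [folklore] -/
theorem exists_excParam_of_isLocalBlowupAlong {B B' : Subring K} {I : Ideal B} (hbl : IsLocalBlowupAlong O B I B') :
    ∃ x : K, (∃ hx : x ∈ B, (⟨x, hx⟩ : B) ∈ I) ∧ x ≠ 0 ∧ ∀ y : B, y ∈ I → O.valuation (y : K) ≤ O.valuation x := by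
  classical
  obtain ⟨hB, u, u₀, hu, hu₀, h0, hval, -⟩ := hbl
  have hu₀I : u₀ ∈ I := hu ▸ Ideal.subset_span hu₀
  refine ⟨u₀, ⟨u₀.2, by simpa using hu₀I⟩, fun e => h0 (Subtype.ext e), fun y hy => ?_⟩
  rw [← hu] at hy
  obtain ⟨c, -, hc⟩ := Submodule.mem_span_finset.mp hy
  rw [← hc]
  push_cast
  refine O.valuation.map_sum_le fun a ha => ?_
  rw [smul_eq_mul, Subring.coe_mul, map_mul]
  have hca : O.valuation ((c a : B) : K) ≤ 1 := (O.valuation_le_one_iff _).mpr (hB (c a).2)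
  calc O.valuation ((c a : B) : K) * O.valuation ((a : B) : K)
      ≤ 1 * O.valuation ((u₀ : B) : K) := mul_le_mul' hca (hval a ha)
    _ = O.valuation ((u₀ : B) : K) := one_mul _

/-- In a member `S` dominated by `O`, a non-unit has `O`-value `< 1` (a value-`1` element has its inverse in `O`, hence in `S` by
domination). [folklore] -/
theorem valuation_lt_one_of_not_isUnit {S : Subring K} (hdom : SubringDominates S O.toSubring) (y : S) (hy : ¬ IsUnit y) :
    O.valuation (y : K) < 1 := by
  have hle : O.valuation (y : K) ≤ 1 := (O.valuation_le_one_iff _).mpr (hdom.1 y.2)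
  rcases hle.lt_or_eq with hlt | heq
  · exact hlt
  · exfalso
    apply hy
    have h0 : (y : K) ≠ 0 := fun e => by rw [e, map_zero] at heq; exact zero_ne_one heq
    have hinvO : (y : K)⁻¹ ∈ O.toSubring := by
      change (y : K)⁻¹ ∈ O
      rw [← O.valuation_le_one_iff, map_inv₀, heq, inv_one]
    exact (isUnit_subring_iff_inv_mem y).mpr ⟨h0, hdom.2 _ y.2 hinvO⟩

/-! ## §2 A parameter that stays exceptional at every later point step is persistent in the weak sense -/

section Run

variable {R : ℕ → Subring K} {P : (i : ℕ) → Ideal (R i)}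

/-- At a point step `j` of a tower dominated by `O`, every element of `R j` of value `< 1` lies in the centre `P j` (= the maximal
ideal). [folklore] -/
theorem mem_centre_of_isPointStep_of_valuation_lt_one (hRO : ∀ i, R i ≤ O.toSubring) {j : ℕ} (hpt : IsPointStep R P j)
    (y : R j) (hvy : O.valuation (y : K) < 1) : y ∈ P j := by
  obtain ⟨hloc, hP⟩ := hpt
  rw [hP]
  exact QuadraticStep.mem_maximalIdeal_of_valuation_lt_one (hRO j) y hvy

/-- **Weak persistence from a persistent parameter.** Along a tower of local blowing ups dominated by `O` whose point steps recur, if one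
element `x` is an exceptional parameter (non-zero element of the centre of maximal `O`-value — `IsExcParamAlong` unfolded) at EVERY point step
`j ≥ j₁`, then the weak persistence clause of `OddBranchVFree.discrete_of_persistent'` holds for `x` from `j₁` on. [folklore] -/
theorem weakPersistence_of_persistentParam (hbl : ∀ i, IsLocalBlowupAlong O (R i) (P i) (R (i + 1)))
    (hrec : ∀ i₀, ∃ i, i₀ ≤ i ∧ IsPointStep R P i) {x : K} (hx0 : x ≠ 0) {j₁ : ℕ}
    (hpers : ∀ j, j₁ ≤ j → IsPointStep R P j →
      (∃ hx : x ∈ R j, (⟨x, hx⟩ : R j) ∈ P j) ∧ ∀ y : R j, y ∈ P j → O.valuation (y : K) ≤ O.valuation x) :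
    ∀ i, j₁ ≤ i → ∀ y ∈ R i, O.valuation y < 1 → ∃ j, i < j ∧ y / x ∈ R j := by
  have hRO : ∀ i, R i ≤ O.toSubring := OddBranchPersistence.le_valuationSubring_of_seq hbl
  refine OddBranchPersistence.weakPersistence_of_pointSteps hbl hx0 fun i hi => ?_
  obtain ⟨j, hij, hpt⟩ := hrec i
  obtain ⟨hxP, hmax⟩ := hpers j (hi.trans hij) hpt
  exact ⟨j, hij, fun y hvy => mem_centre_of_isPointStep_of_valuation_lt_one hRO hpt y hvy, hxP, hmax⟩

/-! ## §3 Non-persistence ⇒ switches beyond every stage -/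

/-- **(S4) Non-persistence ⇒ the exceptional parameter switches beyond every stage.** Along a tower of local blowing ups dominated by `O`
(`R 0` dominated, hence every member) whose point steps recur, if the weak persistence clause FAILS (the (Par-S) binder, verbatim), then beyond
every stage `i₀` there is a point step `j` every exceptional parameter of which fails to be an exceptional parameter at some later point step.
[cite: HeinzerEtAl2015, Remark 2.4] [folklore] -/
theorem exists_switch_beyond_of_not_persistent (hbl : ∀ i, IsLocalBlowupAlong O (R i) (P i) (R (i + 1)))
    (h0 : SubringDominates (R 0) O.toSubring) (hrec : ∀ i₀, ∃ i, i₀ ≤ i ∧ IsPointStep R P i)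
    (hnp : ¬ ∃ i₀ : ℕ, ∃ x : K, x ≠ 0 ∧ x ∈ O ∧ O.valuation x < 1 ∧
      ∀ i, i₀ ≤ i → ∀ y ∈ R i, O.valuation y < 1 → ∃ j, i < j ∧ y / x ∈ R j) (i₀ : ℕ) :
    ∃ j, i₀ ≤ j ∧ IsPointStep R P j ∧ ∀ x : K,
      (∃ hx : x ∈ R j, (⟨x, hx⟩ : R j) ∈ P j) → x ≠ 0 → (∀ y : R j, y ∈ P j → O.valuation (y : K) ≤ O.valuation x) →
      ∃ j', j < j' ∧ IsPointStep R P j' ∧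
        ¬ ((∃ hx : x ∈ R j', (⟨x, hx⟩ : R j') ∈ P j') ∧ ∀ y : R j', y ∈ P j' → O.valuation (y : K) ≤ O.valuation x) := by
  have hRO : ∀ i, R i ≤ O.toSubring := OddBranchPersistence.le_valuationSubring_of_seq hbl
  have hdom : ∀ i, SubringDominates (R i) O.toSubring :=
    SigmaTopLegality.subringDominates_of_isLocalBlowup O R h0 fun i => (hbl i).isLocalBlowup
  by_contra hcon
  push Not at hcon
  -- hcon : ∀ j ≥ i₀, IsPointStep j → ∃ x, (x ∈ P j) ∧ x ≠ 0 ∧ max ∧ ∀ j' > j, IsPointStep j' → (x ∈ P j' ∧ max)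
  obtain ⟨j₁, hj₁, hpt₁⟩ := hrec i₀
  obtain ⟨x, hxP₁, hx0, hmax₁, hlater⟩ := hcon j₁ hj₁ hpt₁
  apply hnp
  obtain ⟨hxR, hxP⟩ := hxP₁
  have hxO : x ∈ O := hRO j₁ hxR
  have hvx : O.valuation x < 1 := by
    obtain ⟨hloc, hP⟩ := hpt₁
    have hm : (⟨x, hxR⟩ : R j₁) ∈ maximalIdeal (R j₁) := hP ▸ hxP
    exact valuation_lt_one_of_not_isUnit (hdom j₁) ⟨x, hxR⟩ ((mem_maximalIdeal _).mp hm)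
  refine ⟨j₁, x, hx0, hxO, hvx, weakPersistence_of_persistentParam hbl hrec hx0 fun j hj hptj => ?_⟩
  rcases hj.lt_or_eq with hlt | heq
  · exact hlater j hlt hptj
  · subst heq
    exact ⟨⟨hxR, hxP⟩, hmax₁⟩

/-- **(S4′) Switch PAIRS beyond every stage.** Under the same hypotheses, beyond every stage there are point steps `j < j'` and an element
`x` which IS an exceptional parameter of step `j` and is NOT one of step `j'`. [folklore] -/
theorem exists_switch_pair_beyond_of_not_persistent (hbl : ∀ i, IsLocalBlowupAlong O (R i) (P i) (R (i + 1)))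
    (h0 : SubringDominates (R 0) O.toSubring) (hrec : ∀ i₀, ∃ i, i₀ ≤ i ∧ IsPointStep R P i)
    (hnp : ¬ ∃ i₀ : ℕ, ∃ x : K, x ≠ 0 ∧ x ∈ O ∧ O.valuation x < 1 ∧
      ∀ i, i₀ ≤ i → ∀ y ∈ R i, O.valuation y < 1 → ∃ j, i < j ∧ y / x ∈ R j) (i₀ : ℕ) :
    ∃ j j' : ℕ, ∃ x : K, i₀ ≤ j ∧ j < j' ∧ IsPointStep R P j ∧ IsPointStep R P j' ∧
      ((∃ hx : x ∈ R j, (⟨x, hx⟩ : R j) ∈ P j) ∧ x ≠ 0 ∧ ∀ y : R j, y ∈ P j → O.valuation (y : K) ≤ O.valuation x) ∧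
      ¬ ((∃ hx : x ∈ R j', (⟨x, hx⟩ : R j') ∈ P j') ∧ ∀ y : R j', y ∈ P j' → O.valuation (y : K) ≤ O.valuation x) := by
  obtain ⟨j, hj, hpt, hsw⟩ := exists_switch_beyond_of_not_persistent hbl h0 hrec hnp i₀
  obtain ⟨x, hxP, hx0, hmax⟩ := exists_excParam_of_isLocalBlowupAlong (hbl j)
  obtain ⟨j', hjj', hpt', hnot⟩ := hsw x hxP hx0 hmax
  exact ⟨j, j', x, hj, hjj', hpt, hpt', ⟨hxP, hx0, hmax⟩, hnot⟩

end Run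

end SwitchRecurrence

end Summit.ResolutionOfSingularities.ResolutionOfSingularities.Theorems.SwitchingDichotomy
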